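import Literature.RingTheory.PBasis.KimuraNiitsuma1980
import HarnessLib

/-!
# Route `RadicialJung`, crux `CleanModels` (stmt-15917): `p`-INDEPENDENCE IN A FIELD OF
# CHARACTERISTIC `p` — EXCHANGE AND MAXIMAL `p`-INDEPENDENT SUBSETS — piece (F1) of the T2
# `p`-basis discharge

Support file (OURS) for PROGRAMME-clean-dim2 / T2 (`HOME/L/res-L0-w81-pv-2/g5/T2-ARCHITECTURE.md`).

For a field `κ` of characteristic `p`, a subset `B ⊆ κ` is *`p`-independent* (over `κ^p`) when
for every finite family `b_1, …, b_s` of distinct elements of `B` the `p^s` monomials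
`∏ b_i^{n_i}` (`0 ≤ n_i < p`) are linearly independent over `κ^p = (frobenius κ p).range` — the
second clause of `IsPBasisOver` (Kimura–Niitsuma's printed definition), written out in full below
(no new definition is introduced).

* `linearIndependent_pow_of_not_mem` — if `F ⊇ κ^p` is a subfield and `c ∉ F`, then
  `1, c, …, c^{p-1}` are linearly independent over `F` (the minimal polynomial of `c` divides
  `X^p - c^p = (X - c)^p`, so it is `(X - c)^e`; for `e < p` its second coefficient `-e c` would put
  `c` in `F`).
* `pIndep_insert` — **exchange**: if `B` is `p`-independent and `c ∉ κ^p[B]`, then `B ∪ {c}` is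
  `p`-independent.
* `exists_maximal_pIndep` — Zorn: inside any `Y ⊆ κ`, a `p`-independent `B₀ ⊆ Y` extends to a
  `p`-independent `B ⊆ Y` with `Y ⊆ κ^p[B]`.
Here `κ^p[B] = Subring.closure (range (frobenius κ p) ∪ B)`, which is a subfield
(`inv_mem_subringClosure_of_frobenius`: `z⁻¹ = z^{p-1} (z⁻¹)^p`).

References: T. Kimura, H. Niitsuma, J. Math. Soc. Japan 32 (1980), §1 (`p`-bases);
N. Bourbaki, *Algèbre* V §13 (`p`-bases, exchange). [cite: KimuraNiitsuma1980, p. 363 l. 7–10]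
-/

noncomputable section

open Polynomial
open Literature.RingTheory.PBasis

namespace Summit.ResolutionOfSingularities.ResolutionOfSingularities.Theorems.RadicialJung.CleanModels

universe u

variable {κ : Type u} [Field κ] (p : ℕ) [Fact p.Prime] [CharP κ p]

/-! ## `κ^p[B]` is a field -/

/-- A subring of `κ` containing all `p`-th powers is closed under inverses:
`z⁻¹ = z^{p-1} · (z⁻¹)^p`. [folklore] -/
theorem inv_mem_subringClosure_of_frobenius (s : Set κ) (hs : Set.range (frobenius κ p) ⊆ s)
    {z : κ} (hz : z ∈ Subring.closure s) : z⁻¹ ∈ Subring.closure s := by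
  have hp : 1 ≤ p := (Fact.out : p.Prime).one_lt.le
  by_cases hz0 : z = 0
  · rw [hz0, inv_zero]; exact Subring.zero_mem _
  have h2 : z⁻¹ = z ^ (p - 1) * (z⁻¹) ^ p := by
    obtain ⟨q, hq⟩ : ∃ q, p = q + 1 := ⟨p - 1, (Nat.sub_add_cancel hp).symm⟩
    rw [hq, Nat.add_sub_cancel, pow_succ, ← mul_assoc, ← mul_pow, mul_inv_cancel₀ hz0, one_pow,
      one_mul]
  rw [h2]
  exact Subring.mul_mem _ (Subring.pow_mem _ hz _)
    (Subring.subset_closure (hs ⟨z⁻¹, frobenius_def _ _⟩))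

/-- `κ^p[s]` as a subring coincides with the subfield it generates. [folklore] -/
theorem subfieldClosure_toSubring_eq (s : Set κ) (hs : Set.range (frobenius κ p) ⊆ s) :
    (Subfield.closure s).toSubring = Subring.closure s := by
  let F : Subfield κ :=
    { Subring.closure s with
      inv_mem' := fun z hz => inv_mem_subringClosure_of_frobenius p s hs hz }
  apply le_antisymm
  · have h : Subfield.closure s ≤ F := Subfield.closure_le.mpr fun z hz => Subring.subset_closure hz
    exact fun z hz => h hz
  · exact Subring.closure_le.mpr fun z hz => Subfield.subset_closure hz

/-- Membership form of `subfieldClosure_toSubring_eq`. [folklore] -/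
theorem mem_subfieldClosure_iff (s : Set κ) (hs : Set.range (frobenius κ p) ⊆ s) (z : κ) :
    z ∈ Subfield.closure s ↔ z ∈ Subring.closure s := by
  rw [← Subfield.mem_toSubring, subfieldClosure_toSubring_eq p s hs]

/-! ## Powers of an element outside a subfield containing `κ^p` -/

/-- If `F ⊇ κ^p` is a subfield of `κ` and `c ∉ F`, then the minimal polynomial of `c` over `F` has
degree `p`, so `1, c, …, c^{p-1}` are linearly independent over `F`. [folklore] -/
theorem linearIndependent_pow_of_not_mem (F : Subfield κ) (hF : Set.range (frobenius κ p) ⊆ F)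
    {c : κ} (hc : c ∉ F) : LinearIndependent F (fun j : Fin p => c ^ (j : ℕ)) := by
  have hp : p.Prime := Fact.out
  -- `c` is integral: `c^p ∈ F`
  have hcp : c ^ p ∈ F := hF ⟨c, frobenius_def _ _⟩
  have hint : IsIntegral F c := by
    refine IsIntegral.of_pow hp.pos ?_
    have : c ^ p = algebraMap F κ ⟨c ^ p, hcp⟩ := rfl
    rw [this]; exact isIntegral_algebraMap
  -- the minimal polynomial divides `X^p - c^p = (X - c)^p`
  set q := minpoly F c with hq
  have hqmonic : q.Monic := minpoly.monic hint
  have hdvd : q ∣ X ^ p - C (⟨c ^ p, hcp⟩ : F) := by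
    apply minpoly.dvd
    simp only [map_sub, map_pow, aeval_X, aeval_C]
    exact sub_eq_zero.mpr rfl
  have hmap : (X ^ p - C (⟨c ^ p, hcp⟩ : F)).map (algebraMap F κ) = (X - C c) ^ p := by
    rw [Polynomial.map_sub, Polynomial.map_pow, map_X, map_C, sub_pow_char, ← C_pow]
    rfl
  have hdvd' : q.map (algebraMap F κ) ∣ (X - C c) ^ p := hmap ▸ Polynomial.map_dvd _ hdvd
  obtain ⟨e, hep, hassoc⟩ := (dvd_prime_pow (prime_X_sub_C c) p).mp hdvd'
  have heq : q.map (algebraMap F κ) = (X - C c) ^ e :=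
    eq_of_monic_of_associated (hqmonic.map _) ((monic_X_sub_C c).pow e) hassoc
  have hdeg : q.natDegree = e := by
    have h1 : (q.map (algebraMap F κ)).natDegree = e := by
      rw [heq, natDegree_pow, natDegree_X_sub_C, mul_one]
    rwa [natDegree_map_eq_of_injective (algebraMap F κ).injective] at h1
  have he1 : 1 ≤ e := hdeg ▸ (minpoly.natDegree_pos hint)
  -- `e = p`: otherwise the second coefficient `-e c` of `(X - c)^e` lies in `F`
  have hep' : e = p := by
    by_contra hne
    have hlt : e < p := lt_of_le_of_ne hep hne
    have hcoef : ((X - C c) ^ e).coeff (e - 1) = -((e : κ) * c) := by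
      rw [sub_eq_add_neg, ← map_neg C c, coeff_X_add_C_pow, Nat.sub_sub_self he1, pow_one,
        Nat.choose_symm he1, Nat.choose_one_right]
      ring
    have hmem : ((X - C c) ^ e).coeff (e - 1) ∈ F := by
      rw [← heq, coeff_map]
      exact (q.coeff (e - 1)).2
    rw [hcoef] at hmem
    have hmem' : (e : κ) * c ∈ F := by simpa using F.neg_mem hmem
    have he0 : (e : κ) ≠ 0 := by
      rw [Ne, CharP.cast_eq_zero_iff κ p e]
      exact fun h => absurd (Nat.le_of_dvd he1 h) (not_le.mpr hlt)
    apply hc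
    have : c = ((e : κ))⁻¹ * ((e : κ) * c) := by rw [← mul_assoc, inv_mul_cancel₀ he0, one_mul]
    rw [this]
    exact F.mul_mem (F.inv_mem (natCast_mem F e)) hmem'
  have h := linearIndependent_pow (K := F) c
  rw [← hq, hdeg, hep'] at h
  exact h

/-! ## Exchange -/

/-- **Exchange lemma for `p`-independence**: if `B` is `p`-independent over `κ^p` and
`c ∉ κ^p[B]`, then `B ∪ {c}` is `p`-independent. [folklore] -/
theorem pIndep_insert (B : Set κ)
    (hB : ∀ (s : ℕ) (b : Fin s → κ), Function.Injective b → (∀ i, b i ∈ B) →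
      LinearIndependent (frobenius κ p).range (fun n : Fin s → Fin p => ∏ i, b i ^ (n i : ℕ)))
    {c : κ} (hc : c ∉ Subring.closure (Set.range (frobenius κ p) ∪ B)) :
    ∀ (s : ℕ) (b : Fin s → κ), Function.Injective b → (∀ i, b i ∈ insert c B) →
      LinearIndependent (frobenius κ p).range (fun n : Fin s → Fin p => ∏ i, b i ^ (n i : ℕ)) := by
  classical
  intro s b hb hmem
  by_cases hcs : ∃ i₀, b i₀ = c
  swap
  · push Not at hcs
    exact hB s b hb fun i => (hmem i).resolve_left (hcs i)
  obtain ⟨i₀, hi₀⟩ := hcs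
  obtain ⟨s', rfl⟩ : ∃ s', s = s' + 1 := ⟨s - 1, (Nat.succ_pred_eq_of_pos i₀.pos).symm⟩
  -- the other elements
  let b' : Fin s' → κ := fun j => b (i₀.succAbove j)
  have hb' : Function.Injective b' := hb.comp Fin.succAbove_right_injective
  have hb'B : ∀ j, b' j ∈ B := fun j =>
    (hmem _).resolve_left fun h => Fin.succAbove_ne i₀ j (hb (h.trans hi₀.symm))
  -- the subfield `F = κ^p(B)` and `c ∉ F`
  have hsub : Set.range (frobenius κ p) ⊆ Set.range (frobenius κ p) ∪ B := Set.subset_union_left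
  let F : Subfield κ := Subfield.closure (Set.range (frobenius κ p) ∪ B)
  have hcF : c ∉ F := fun h => hc ((mem_subfieldClosure_iff p _ hsub c).mp h)
  have hFp : Set.range (frobenius κ p) ⊆ F := fun z hz => Subfield.subset_closure (hsub hz)
  have hpow := linearIndependent_pow_of_not_mem p F hFp hcF
  have hb'F : ∀ l, b' l ∈ F := fun l =>
    Subfield.subset_closure (Set.mem_union_right (Set.range (frobenius κ p)) (hb'B l))
  rw [Fintype.linearIndependent_iff]
  intro g hg n₁
  simp only [Subring.smul_def, smul_eq_mul] at hg
  -- split off the exponent of `c`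
  let e := Fin.insertNthEquiv (fun _ : Fin (s' + 1) => Fin p) i₀
  let μ : Fin p → κ := fun j => ∑ n' : Fin s' → Fin p, (g (e (j, n')) : κ) * ∏ l, b' l ^ (n' l : ℕ)
  have hmon : ∀ n : Fin (s' + 1) → Fin p,
      ∏ i, b i ^ (n i : ℕ) = c ^ (n i₀ : ℕ) * ∏ l, b' l ^ (n (i₀.succAbove l) : ℕ) := by
    intro n
    rw [Fin.prod_univ_succAbove _ i₀, hi₀]
  have hsum : ∑ j : Fin p, μ j * c ^ (j : ℕ) = 0 := by
    rw [← hg, ← e.sum_comp, Fintype.sum_prod_type]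
    refine Finset.sum_congr rfl fun j _ => ?_
    rw [Finset.sum_mul]
    refine Finset.sum_congr rfl fun n' _ => ?_
    rw [hmon]
    simp only [e, Fin.insertNthEquiv_apply, Fin.insertNth_apply_same, Fin.insertNth_apply_succAbove]
    ring
  have hμF : ∀ j, μ j ∈ F := by
    intro j
    refine sum_mem fun n' _ => mul_mem ?_ ?_
    · obtain ⟨w, hw⟩ := (g (e (j, n'))).2
      exact hFp ⟨w, hw⟩
    · exact prod_mem fun l _ => pow_mem (hb'F l) _
  have hμ0 : ∀ j, μ j = 0 := by
    intro j
    have hsum' : ∑ j : Fin p, (⟨μ j, hμF j⟩ : F) • c ^ (j : ℕ) = 0 := by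
      rw [← hsum]
      exact Finset.sum_congr rfl fun j _ => by rw [Algebra.smul_def]; rfl
    have := Fintype.linearIndependent_iff.mp hpow (fun j => ⟨μ j, hμF j⟩) hsum' j
    exact congrArg Subtype.val this
  -- now the `B`-independence finishes
  have hB' := Fintype.linearIndependent_iff.mp (hB s' b' hb' hb'B) (fun n' => g (e (n₁ i₀, n')))
    (by simpa only [Subring.smul_def, smul_eq_mul] using hμ0 (n₁ i₀)) (i₀.removeNth n₁)
  have he : e (n₁ i₀, i₀.removeNth n₁) = n₁ := e.apply_symm_apply n₁
  rwa [he] at hB'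

/-! ## Maximal `p`-independent subsets -/

/-- **Maximal `p`-independent subsets** (Zorn): a `p`-independent `B₀ ⊆ Y` extends to a
`p`-independent `B ⊆ Y` such that `Y ⊆ κ^p[B]`. [folklore] -/
theorem exists_maximal_pIndep (Y B₀ : Set κ) (h₀ : B₀ ⊆ Y)
    (hB₀ : ∀ (s : ℕ) (b : Fin s → κ), Function.Injective b → (∀ i, b i ∈ B₀) →
      LinearIndependent (frobenius κ p).range (fun n : Fin s → Fin p => ∏ i, b i ^ (n i : ℕ))) :
    ∃ B : Set κ, B₀ ⊆ B ∧ B ⊆ Y ∧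
      (∀ (s : ℕ) (b : Fin s → κ), Function.Injective b → (∀ i, b i ∈ B) →
        LinearIndependent (frobenius κ p).range (fun n : Fin s → Fin p => ∏ i, b i ^ (n i : ℕ))) ∧
      Y ⊆ Subring.closure (Set.range (frobenius κ p) ∪ B) := by
  let S : Set (Set κ) := {B | B₀ ⊆ B ∧ B ⊆ Y ∧
    ∀ (s : ℕ) (b : Fin s → κ), Function.Injective b → (∀ i, b i ∈ B) →
      LinearIndependent (frobenius κ p).range (fun n : Fin s → Fin p => ∏ i, b i ^ (n i : ℕ))}
  have hchain : ∀ c ⊆ S, IsChain (· ⊆ ·) c → c.Nonempty → ∃ ub ∈ S, ∀ s ∈ c, s ⊆ ub := by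
    intro c hcS hc hne
    refine ⟨⋃₀ c, ⟨?_, ?_, ?_⟩, fun s hs => Set.subset_sUnion_of_mem hs⟩
    · obtain ⟨t, ht⟩ := hne
      exact (hcS ht).1.trans (Set.subset_sUnion_of_mem ht)
    · exact Set.sUnion_subset fun t ht => (hcS ht).2.1
    · intro s b hb hbmem
      have hfin : (Set.range b).Finite := Set.finite_range b
      obtain ⟨t, htc, hbt⟩ := hc.directedOn.exists_mem_subset_of_finite_of_subset_sUnion hne hfin
        (Set.range_subset_iff.mpr hbmem)
      exact (hcS htc).2.2 s b hb fun i => hbt ⟨i, rfl⟩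
  obtain ⟨B, hB₀B, hmax⟩ := zorn_subset_nonempty S hchain B₀ ⟨le_rfl, h₀, hB₀⟩
  refine ⟨B, hB₀B, hmax.prop.2.1, hmax.prop.2.2, fun y hy => ?_⟩
  by_contra hyc
  have hins : insert y B ∈ S :=
    ⟨hB₀B.trans (Set.subset_insert _ _), Set.insert_subset hy hmax.prop.2.1,
      pIndep_insert p B hmax.prop.2.2 hyc⟩
  have hyB : y ∈ B := hmax.2 hins (Set.subset_insert _ _) (Set.mem_insert _ _)
  exact hyc (Subring.subset_closure (Or.inr hyB))

end Summit.ResolutionOfSingularities.ResolutionOfSingularities.Theorems.RadicialJung.CleanModels
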